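import Literature.NumberTheory.EllipticCurves.PastenValuationProductThm75LeavesProofs
import HarnessLib

/-!
# Murty's bound for a distinguishing index of two newforms (named fact), and Pasten's
# Theorem 7.5 assembled from the named facts of the tree

Topic `NumberTheory/EllipticCurves`; namespace `Literature.NumberTheory.EllipticCurves`.
Fact-decomposition record (librarian, `fact-decompose`, 2026-08-16) for the named fact
`pasten_thm_7_5` (`PastenValuationProduct.lean`; H. Pasten, *Shimura curves and the abc
conjecture*, J. Number Theory 254 (2024), Thm. 7.5: `log |Δ_E| < (1/4 + ε) N log N` for every
elliptic curve `E/ℚ` of conductor `N ≫_ε 1`).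

State of the printed proof in the tree (`PastenValuationProductThm75LeavesProofs`,
`pasten_thm_7_5_of_exists_isNewformOf` / `…_of_printed_inputs`): every step Pasten PROVES (Thm. 5.5,
Prop. 7.1, Thm. 7.2, the Frey–Zagier degree formula, Silverman's `log |Δ| ≤ 12 h + 16`, the
bookkeeping of §7.4) is a theorem of the tree, and `pasten_thm_7_5` follows from FOUR external
inputs: (1) the Modularity Theorem "Version `a_p`" (`ModularForms.exists_isNewformOf`), (2) the
Mazur–Kenku comparison (`PastenShimura2024_minimalDegree_le_163_mul`), (3) Deligne's bound
(`Deligne1974_heckeT_eigenvalue_norm_le`; only its weight-`2` case, Eichler–Shimura–Igusa–Weil, is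
used) — named facts of the tree — and (4) Murty's Lemma 11, "`n_c ≪_ε N^{1+ε}`" as used on p. 26
of Pasten's proof of Thm. 7.2 (asymptotic clause): "The proof of the asymptotic bound is similar,
but using instead the (effective) estimate `n_c ≪_ε N^{1+ε}` from Lemma 11 in [MurtyBounds]"
[cite: PastenShimura2024, Theorem 7.2 (proof, p. 26)], carried so far only as the inline hypothesis
`hMurty` of those theorems.

This file NAMES input (4) as the fact `murty1999_lemma11_distinguishingIndex` (the binder `hMurty`
verbatim) and records the assembly `pasten_thm_7_5_holds_of` from the four named inputs (one line).
Source status of (4): M. R. Murty, *Bounds for congruence primes*, Proc. Sympos. Pure Math. 66.1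
(1999), §6 Lemma 11 is cite-only on this hub (not held); the rendering is the one fixed by the
tree's Pasten cluster from Pasten's use of it — `f` a normalised newform of weight `2` and level
`N`, `g` a normalised newform of weight `2` and level `M ∣ N` (Pasten: `g ∈ S₂(Dd)^{new}`, `D = 1`,
`d ∣ N`), `f, g` differing at some index coprime to `N`, Murty's auxiliary modulus taken to be `N`:
a distinguishing index `n ≤ C_ε N^{1+ε}` coprime to `N` [cite: Murty1999CongruencePrimes, §6 Lemma 11].
When the primary text is acquired the statement printed there should be vendored next to this one
(new name) and this one derived from it.

## References

* [PastenShimura2024] H. Pasten, Shimura curves and the abc conjecture, J. Number Theory 254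
  (2024) 214–335 = arXiv:1705.09251: Thm. 7.2 and its proof (p. 26), §7.4 Thm. 7.5 (p. 27).
* [Murty1999CongruencePrimes] M. R. Murty, Bounds for congruence primes, in: Automorphic forms,
  automorphic representations, and arithmetic (Fort Worth 1996), Proc. Sympos. Pure Math. 66.1,
  AMS 1999, 177–192: §6 Lemma 11.
-/

noncomputable section

open scoped MatrixGroups ModularForm

open CongruenceSubgroup UpperHalfPlane

namespace Literature.NumberTheory.EllipticCurves

open ModularForms WeierstrassCurve

/-- NAMED FACT — **Murty's bound for a distinguishing index** (Murty 1999, §6 Lemma 11, in the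
form used by Pasten, proof of Thm. 7.2, p. 26: "`n_c ≪_ε N^{1+ε}`"). For every `ε > 0` there is
`C = C_ε` such that: for `N ≥ 1`, `M ∣ N`, normalised newforms `f ∈ S₂(Γ₀(N))` of level `N` and
`g ∈ S₂(Γ₀(M))` of level `M` (`IsNewform0`) whose `q`-expansions differ at SOME index coprime to
`N`, there is an index `n` coprime to `N` with `n ≤ C · N^{1+ε}` and `aₙ(f) ≠ aₙ(g)`. (Murty: for a
newform `f` of weight `2` and level `N` and another newform `g` there is `n = O_ε(N^{1+ε} M'^ε)`
with `(n, M') = 1` and `aₙ(f) ≠ aₙ(g)`, `M'` an auxiliary modulus — here `M' = N`, as in Pasten's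
application; Rankin–Selberg with a level-uniform convexity bound and the Hoffstein–Lockhart lower
bound for `(f, f)`.) This is the hypothesis `hMurty` of `pasten_thm_7_5_of_exists_isNewformOf`
verbatim; primary source cite-only on this hub (module docstring). Users take
`(h : murty1999_lemma11_distinguishingIndex)`.
[cite: Murty1999CongruencePrimes, §6 Lemma 11] [cite: PastenShimura2024, Theorem 7.2 (proof, p. 26)] -/
def murty1999_lemma11_distinguishingIndex : Prop :=
  ∀ ε : ℝ, 0 < ε → ∃ C : ℝ, ∀ (N M : ℕ) [NeZero N] [NeZero M], M ∣ N →
    ∀ (f : CuspForm (Gamma0 N) 2) (g : CuspForm (Gamma0 M) 2), IsNewform0 f → IsNewform0 g →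
      (∃ n : ℕ, n.Coprime N ∧ (qExpansion 1 ⇑f).coeff n ≠ (qExpansion 1 ⇑g).coeff n) →
        ∃ n : ℕ, n.Coprime N ∧ (n : ℝ) ≤ C * (N : ℝ) ^ (1 + ε) ∧
          (qExpansion 1 ⇑f).coeff n ≠ (qExpansion 1 ⇑g).coeff n

/-- **Assembly (fact-decompose): Pasten's Thm. 7.5 from the four named inputs of its printed
proof** — the Modularity Theorem "Version `a_p`" (`ModularForms.exists_isNewformOf`), the
Mazur–Kenku comparison (`PastenShimura2024_minimalDegree_le_163_mul`), Deligne's bound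
(`Deligne1974_heckeT_eigenvalue_norm_le`) and Murty's Lemma 11
(`murty1999_lemma11_distinguishingIndex`); everything else is proved in the tree
(`pasten_thm_7_5_of_exists_isNewformOf`).
[cite: PastenShimura2024, Theorem 7.5 (proof, §7.4 p. 27) with Thm 7.2 (proof, p. 26)] -/
theorem pasten_thm_7_5_holds_of (h₁ : exists_isNewformOf)
    (h163 : PastenShimura2024_minimalDegree_le_163_mul)
    (hDel : Deligne1974_heckeT_eigenvalue_norm_le)
    (hMurty : murty1999_lemma11_distinguishingIndex) : pasten_thm_7_5 :=
  pasten_thm_7_5_of_exists_isNewformOf h₁ h163 hDel hMurty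

end Literature.NumberTheory.EllipticCurves

end
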